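import Mathlib

/-!
# Crux `EnsembleRealization` (stmt-AnomalousDissipation-0215) — line `augmented-lift`,
# sub-stub (M1a) `stub_augCurrentLevelPairs`, piece (L5)/Transport: disintegration of the level laws

Supports stmt-AnomalousDissipation-0215 (stub `stub_augCurrentLevelPairs` of line
`augmented-lift`, piece L5 `stub_augCurrentLevelLinkTools`, step (A6) of `augCurrent-notes.md`
§3). Nothing here closes an item. Theorems only.

The level law is `m = (1 − ε) p₁ · vol + ε c · vol|_{Bx}` with the mollified coordinate law
`p₁(z) = ∫ ρ(z − Z u) dμ(u)` of a probability measure `μ` (the Foias–Prodi law) under a measurable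
coordinate map `Z` and a continuous integrable kernel `ρ ≥ 0`. For a bounded continuous
observable `G` this file proves the TRANSPORT IDENTITY
`∫ G p₁ dvol = ∫ (∫ G(Z u + y) ρ(y) dvol(y)) dμ(u)` (Fubini and translation invariance), the
integrability and the bound `|∫ G(Z u + y) ρ(y) dy| ≤ B ∫ ρ` of the inner integral, and, for the
uniform part, `c · vol(Bx) = 1` and `|ε c ∫_{Bx} G| ≤ ε B`. Packaged as
`stub_augCurrentLevelTransportTools`.
-/

noncomputable section

set_option linter.dupNamespace false

open MeasureTheory Set Filter Topology Function Metric
open scoped BigOperators ENNReal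

namespace Summit.AnomalousDissipation.AnomalousDissipation.Theorems.EnsembleRealization

/-- Joint integrability of `(z, u) ↦ G(z) ρ(z − Z u)` on `vol ⊗ μ` for bounded continuous `G`,
continuous integrable `ρ`, `μ` a probability measure. -/
theorem integrable_obs_mul_kernel_sub {Ω : Type*} [MeasurableSpace Ω] (μ : Measure Ω) [IsProbabilityMeasure μ]
    {E : Type*} [NormedAddCommGroup E] [NormedSpace ℝ E] [FiniteDimensional ℝ E]
    [MeasurableSpace E] [BorelSpace E] (vol : Measure E) [SFinite vol] [vol.IsAddRightInvariant]
    {Z : Ω → E} (hZ : Measurable Z) {ρ : E → ℝ} (hρ : Continuous ρ) (hρi : Integrable ρ vol)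
    {G : E → ℝ} (hG : Continuous G) {B : ℝ} (hB : ∀ z, |G z| ≤ B) :
    Integrable (uncurry fun z u => G z * ρ (z - Z u)) (vol.prod μ) := by
  have hmK : AEStronglyMeasurable (uncurry fun z u => ρ (z - Z u)) (vol.prod μ) :=
    (hρ.measurable.comp (measurable_fst.sub (hZ.comp measurable_snd))).aestronglyMeasurable
  have hK : Integrable (uncurry fun z u => ρ (z - Z u)) (vol.prod μ) := by
    refine (integrable_prod_iff' hmK).2 ⟨Eventually.of_forall fun u => hρi.comp_sub_right (Z u), ?_⟩
    have : (fun u => ∫ z, ‖ρ (z - Z u)‖ ∂vol) = fun _ => ∫ z, ‖ρ z‖ ∂vol :=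
      funext fun u => integral_sub_right_eq_self (fun y => ‖ρ y‖) (Z u)
    show Integrable (fun u => ∫ z, ‖ρ (z - Z u)‖ ∂vol) μ
    rw [this]
    exact integrable_const _
  have hmH : AEStronglyMeasurable (uncurry fun z u => G z * ρ (z - Z u)) (vol.prod μ) :=
    ((hG.measurable.comp measurable_fst).mul
      (hρ.measurable.comp (measurable_fst.sub (hZ.comp measurable_snd)))).aestronglyMeasurable
  refine (hK.norm.const_mul B).mono' hmH (Eventually.of_forall fun p => ?_)
  simp only [uncurry, Real.norm_eq_abs, abs_mul]
  exact mul_le_mul_of_nonneg_right (hB _) (abs_nonneg _)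

/-- **Transport tools for (M1a), piece (L5).** See the module docstring. -/
theorem stub_augCurrentLevelTransportTools {Ω : Type*} [MeasurableSpace Ω] (μ : Measure Ω) [IsProbabilityMeasure μ]
    {E : Type*} [NormedAddCommGroup E] [NormedSpace ℝ E] [FiniteDimensional ℝ E]
    [MeasurableSpace E] [BorelSpace E] (vol : Measure E) [SFinite vol] [vol.IsAddRightInvariant]
    {Z : Ω → E} (hZ : Measurable Z) {ρ : E → ℝ} (hρ : Continuous ρ) (hρ0 : ∀ y, 0 ≤ ρ y) (hρi : Integrable ρ vol)
    {G : E → ℝ} (hG : Continuous G) {B : ℝ} (hB : ∀ z, |G z| ≤ B) :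
    (∫ z, G z * ∫ u, ρ (z - Z u) ∂μ ∂vol = ∫ u, ∫ y, G (Z u + y) * ρ y ∂vol ∂μ) ∧
    Integrable (fun u => ∫ y, G (Z u + y) * ρ y ∂vol) μ ∧
    (∀ u, |∫ y, G (Z u + y) * ρ y ∂vol| ≤ B * ∫ y, ρ y ∂vol) ∧
    (∀ (m : Measure E) (ε c : ℝ) (p₁ : E → ℝ) (Bx : Set E), IsProbabilityMeasure m → 0 < ε → vol Bx < ∞ →
      ∫ z, p₁ z ∂vol = 1 →
      (∀ G' : E → ℝ, Continuous G' → ∫ z, G' z ∂m = (1 - ε) * ∫ z, G' z * p₁ z ∂vol + ε * c * ∫ z in Bx, G' z ∂vol) →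
      c * (vol Bx).toReal = 1 ∧ |ε * c * ∫ z in Bx, G z ∂vol| ≤ ε * B) := by
  have hB0 : 0 ≤ B := (abs_nonneg _).trans (hB 0)
  have hint := integrable_obs_mul_kernel_sub μ vol hZ hρ hρi hG hB
  -- translation of the inner integral
  have htr : ∀ u, ∫ z, G z * ρ (z - Z u) ∂vol = ∫ y, G (Z u + y) * ρ y ∂vol := fun u => by
    rw [← integral_add_right_eq_self (fun z => G z * ρ (z - Z u)) (Z u)]
    refine integral_congr_ae (Eventually.of_forall fun y => ?_)
    simp only
    rw [add_sub_cancel_right, add_comm]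
  -- (T1) Fubini
  have hT1 : ∫ z, G z * ∫ u, ρ (z - Z u) ∂μ ∂vol = ∫ u, ∫ y, G (Z u + y) * ρ y ∂vol ∂μ := by
    have h1 : (fun z => G z * ∫ u, ρ (z - Z u) ∂μ) = fun z => ∫ u, G z * ρ (z - Z u) ∂μ :=
      funext fun z => (integral_const_mul _ _).symm
    rw [h1, integral_integral_swap hint]
    exact integral_congr_ae (Eventually.of_forall htr)
  -- (T1') integrability and bound of the inner integral
  have hT2 : Integrable (fun u => ∫ y, G (Z u + y) * ρ y ∂vol) μ := by
    have h := hint.integral_prod_right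
    simp only [uncurry] at h
    exact h.congr (Eventually.of_forall htr)
  have hT3 : ∀ u, |∫ y, G (Z u + y) * ρ y ∂vol| ≤ B * ∫ y, ρ y ∂vol := fun u => by
    rw [← Real.norm_eq_abs, ← integral_const_mul]
    refine norm_integral_le_of_norm_le (hρi.const_mul B) (Eventually.of_forall fun y => ?_)
    rw [Real.norm_eq_abs, abs_mul, abs_of_nonneg (hρ0 y)]
    exact mul_le_mul_of_nonneg_right (hB _) (hρ0 y)
  refine ⟨hT1, hT2, hT3, fun m ε c p₁ Bx hm hε hBx hp1 htrans => ?_⟩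
  -- the uniform part: total mass and the `ε`-bound
  have hone := htrans (fun _ => (1 : ℝ)) continuous_const
  simp only [integral_const, smul_eq_mul, mul_one, one_mul, measure_univ, ENNReal.toReal_one,
    Measure.restrict_apply MeasurableSet.univ, univ_inter, hp1, Measure.real] at hone
  have hc : c * (vol Bx).toReal = 1 := by
    have h : ε * (c * (vol Bx).toReal) = ε * 1 := by linarith
    exact mul_left_cancel₀ hε.ne' h
  refine ⟨hc, ?_⟩
  have h1 : |∫ z in Bx, G z ∂vol| ≤ B * (vol Bx).toReal := by
    rw [← Real.norm_eq_abs]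
    exact norm_setIntegral_le_of_norm_le_const hBx fun z _ => by rw [Real.norm_eq_abs]; exact hB z
  have hc0 : 0 < c := by
    by_contra h
    have : c * (vol Bx).toReal ≤ 0 := mul_nonpos_of_nonpos_of_nonneg (not_lt.1 h) ENNReal.toReal_nonneg
    linarith
  rw [abs_mul, abs_mul, abs_of_pos hε, abs_of_pos hc0]
  calc ε * c * |∫ z in Bx, G z ∂vol| ≤ ε * c * (B * (vol Bx).toReal) := by gcongr
    _ = ε * B * (c * (vol Bx).toReal) := by ring
    _ = ε * B := by rw [hc, mul_one]

end Summit.AnomalousDissipation.AnomalousDissipation.Theorems.EnsembleRealization
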